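import Mathlib
import Literature.Analysis.FluidPDE.TypeIAncientMild
import Summits.NavierStokesRegularity.NavierStokesRegularity.Theses.SymmetryModuliCount
import Summits.NavierStokesRegularity.NavierStokesRegularity.Theorems.SymmetryModuliCountForcedSymmetryInteriorVertexVanishing
import Summits.NavierStokesRegularity.NavierStokesRegularity.Theorems.SymmetryModuliCountForcedSymmetryRigidComotionVanishing
import Summits.NavierStokesRegularity.NavierStokesRegularity.Theorems.SymmetryModuliCountForcedSymmetryFutureVertexLiouvilleIrrotational
import Summits.NavierStokesRegularity.NavierStokesRegularity.Theorems.SymmetryModuliCountForcedSymmetryFutureVertexLiouvilleRotated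
import HarnessLib

/-!
# Route SymmetryModuliCount — the residual of crux `ForcedSymmetry` (stmt-NavierStokesRegularity-4052)

Line `time-anchor-bootstrap` (lead prover, gen 3). The crux `ForcedSymmetry` ("every Type-I KNSS-mild
ancient field `u ∈ A_C` has a nonzero infinitesimal similarity symmetry `L_ξ u = 0`, `ξ ∈ sim(3)`,
scalings anchored at the final time `t = 0`") was reduced by the line to five registered stubs. Three
are LANDED unconditionally (`stub_interiorVertexVanishing` p76364, `stub_rigidComotionVanishing` p76798,
`stub_futureVertexLiouvilleIrrotational` p81763), the rotated future-vertex leaf (ROTATED LEAF below: a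
member of `A_C` which is exactly backward rotated-self-similar about a FUTURE vertex vanishes — open in
print, bounded-profile RSS Liouville) is LANDED conditionally on the sibling crux `SymmetricLiouville`
(stmt-4053; `rss_futureVertexLiouvilleRotated_of_symmetricLiouville`, p88100), and the hardest stub —
EXTENDED FORCED SYMMETRY (EFS), the crux re-anchored in the full point-symmetry algebra `⟨∂ₜ⟩ ⊕ sim(3)`
(any space–time vertex, time translation allowed) — is the residual.

This file records, as importable theorems over route decls and the tree class only (no local
definition; EFS and the rotated leaf are written out verbatim each time — they are the registered
signatures of `stub_extendedForcedSymmetry` / `stub_futureVertexLiouvilleRotated`):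

* `extendedForcedSymmetry_of_forcedSymmetry` : `ForcedSymmetry → EFS` (`τ = 0`);
* `forcedSymmetry_of_extended_of_rotatedLeaf` : ROTATED LEAF `→ EFS → ForcedSymmetry` (the line's
  composition fed with the three landed leaves; conditional on the leaf ONLY);
* `forcedSymmetry_of_extended_of_symmetricLiouville` : `SymmetricLiouville → EFS → ForcedSymmetry`;
* `typeIAncientLiouville_iff_extended_of_symmetricLiouville` : `SymmetricLiouville →
  (TypeIAncientLiouville ↔ EFS)`.

ROUTE NOTE (route file rev 6, 2026-08-16): the deciding theorem is
`closes (hF : ForcedSymmetry) (hR : RigidComotionVanishesOnEnd) (hH : HelicalEndLiouville)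
(hA : AxisymEndLiouville) (hB : BackwardEndVanishing) (hK) (hII)`; `SymmetricLiouville` is NOT on the
critical path (the time-anchor collapse — `hF` applied to `u` and to `u(·−1)` — is inlined in `closes`).
EFS is the ATTACK formulation of the one open node (backward-shift invariant; survives blow-down and
recentring; the natural output of any soliton-resolution / unique-blow-down engine), while
`ForcedSymmetry` should stay the `closes` INTERFACE: with EFS in place of `hF` the collapse may return the
same future-vertex soliton generator for `u` and `u(·−1)` and degenerate, so a re-anchored `closes`
would need the (open) rotated leaf on the path. Use: prove EFS, read `ForcedSymmetry` off it here.
All theorems are sorry-free; the second is conditional on the rotated leaf, the last two on the route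
decl `SymmetricLiouville` (hypotheses), nothing else.
-/

noncomputable section

-- `Summit.NavierStokesRegularity.NavierStokesRegularity` repeats a component by design (summit = sub-problem).
set_option linter.dupNamespace false

namespace Summit.NavierStokesRegularity.NavierStokesRegularity.Theorems

open Literature.Analysis.FluidPDE Set Function
open Summit.NavierStokesRegularity.NavierStokesRegularity.Theses.SymmetryModuliCount
  (ForcedSymmetry TypeIAncientLiouville SymmetricLiouville)

/-- The zero field carries the crux's conclusion (translation by `e₀`). [folklore] -/
theorem residual_simSymmetry_of_vanishes
    {u : ℝ → EuclideanSpace ℝ (Fin 3) → EuclideanSpace ℝ (Fin 3)} (h : ∀ t < 0, ∀ x, u t x = 0) :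
    ∃ (a : EuclideanSpace ℝ (Fin 3)) (σ : ℝ) (A : EuclideanSpace ℝ (Fin 3) →L[ℝ] EuclideanSpace ℝ (Fin 3)),
      (∀ x, inner ℝ (A x) x = 0) ∧ ¬ (a = 0 ∧ σ = 0 ∧ A = 0) ∧
      ∀ t < 0, ∀ x, fderiv ℝ (u t) x (a + σ • x + A x) + σ • u t x +
        (2 * σ * t) • timeDeriv u t x - A (u t x) = 0 := by
  refine ⟨EuclideanSpace.single 0 1, 0, 0, fun x => by simp, ?_, ?_⟩
  · rintro ⟨h0, -, -⟩
    have := congrArg (fun v : EuclideanSpace ℝ (Fin 3) => v 0) h0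
    simp at this
  · intro t ht x
    have hut : u t = fun _ => 0 := funext (h t ht)
    simp [hut]

/-- **The crux implies its re-anchored form** (take `τ = 0`). [folklore] -/
theorem extendedForcedSymmetry_of_forcedSymmetry (hFS : ForcedSymmetry) :
    ∀ (C : ℝ) (u : ℝ → EuclideanSpace ℝ (Fin 3) → EuclideanSpace ℝ (Fin 3)),
      Literature.Analysis.FluidPDE.IsTypeIAncientMild C u →
      ∃ (a : EuclideanSpace ℝ (Fin 3)) (σ : ℝ) (A : EuclideanSpace ℝ (Fin 3) →L[ℝ] EuclideanSpace ℝ (Fin 3)) (τ : ℝ),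
        (∀ x, inner ℝ (A x) x = 0) ∧ ¬ (a = 0 ∧ σ = 0 ∧ A = 0 ∧ τ = 0) ∧
        ∀ t < 0, ∀ x, fderiv ℝ (u t) x (a + σ • x + A x) + σ • u t x +
          (2 * σ * t + τ) • Literature.Analysis.FluidPDE.timeDeriv u t x - A (u t x) = 0 := by
  intro C u hu
  obtain ⟨a, σ, A, hA, hne, h⟩ := hFS C u (isTypeIAncientMild_iff.1 hu)
  refine ⟨a, σ, A, 0, hA, fun hh => hne ⟨hh.1, hh.2.1, hh.2.2.1⟩, fun t ht x => ?_⟩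
  rw [add_zero]
  exact h t ht x

/-- **The line's composition, modulo the rotated leaf only.** If the ROTATED LEAF holds (a member of
`A_C` annihilated by a rotated scaling generator about a future vertex vanishes — registered stub
`stub_futureVertexLiouvilleRotated`, open in print), extended forced symmetry implies the crux
`ForcedSymmetry`: take the extended generator `(a, σ, A, τ)`; `τ = 0` is a crux witness; `σ = 0 ≠ τ` is a
rigid co-motion, lethal by `stub_rigidComotionVanishing` (p76798); for `σ ≠ 0 ≠ τ` the vertex
`θ = −τ/(2σ)` is interior (`stub_interiorVertexVanishing`, p76364) or future
(`stub_futureVertexLiouvilleIrrotational`, p81763, for `A = 0`; the hypothesis for `A ≠ 0`); a vanishing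
field is symmetric. CONDITIONAL on the rotated leaf only. [folklore] -/
theorem forcedSymmetry_of_extended_of_rotatedLeaf
    (hRot : ∀ (C : ℝ) (u : ℝ → EuclideanSpace ℝ (Fin 3) → EuclideanSpace ℝ (Fin 3)),
      Literature.Analysis.FluidPDE.IsTypeIAncientMild C u →
      ∀ (a : EuclideanSpace ℝ (Fin 3)) (σ : ℝ) (A : EuclideanSpace ℝ (Fin 3) →L[ℝ] EuclideanSpace ℝ (Fin 3)) (θ : ℝ),
        (∀ x, inner ℝ (A x) x = 0) → A ≠ 0 → σ ≠ 0 → 0 < θ →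
        (∀ t < 0, ∀ x, fderiv ℝ (u t) x (a + σ • x + A x) + σ • u t x +
          (2 * σ * (t - θ)) • Literature.Analysis.FluidPDE.timeDeriv u t x - A (u t x) = 0) →
        ∀ t < 0, ∀ x, u t x = 0)
    (hE : ∀ (C : ℝ) (u : ℝ → EuclideanSpace ℝ (Fin 3) → EuclideanSpace ℝ (Fin 3)),
      Literature.Analysis.FluidPDE.IsTypeIAncientMild C u →
      ∃ (a : EuclideanSpace ℝ (Fin 3)) (σ : ℝ) (A : EuclideanSpace ℝ (Fin 3) →L[ℝ] EuclideanSpace ℝ (Fin 3)) (τ : ℝ),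
        (∀ x, inner ℝ (A x) x = 0) ∧ ¬ (a = 0 ∧ σ = 0 ∧ A = 0 ∧ τ = 0) ∧
        ∀ t < 0, ∀ x, fderiv ℝ (u t) x (a + σ • x + A x) + σ • u t x +
          (2 * σ * t + τ) • Literature.Analysis.FluidPDE.timeDeriv u t x - A (u t x) = 0) :
    ForcedSymmetry := by
  intro C u hu
  have hu' : IsTypeIAncientMild C u := isTypeIAncientMild_iff.2 hu
  obtain ⟨a, σ, A, τ, hA, hne, hgen⟩ := hE C u hu'
  by_cases hτ : τ = 0
  · subst hτ
    refine ⟨a, σ, A, hA, fun h => hne ⟨h.1, h.2.1, h.2.2, rfl⟩, fun t ht x => ?_⟩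
    rw [← add_zero (2 * σ * t)]
    exact hgen t ht x
  by_cases hσ : σ = 0
  · subst hσ
    refine residual_simSymmetry_of_vanishes
      (stub_rigidComotionVanishing C u hu' a A τ hA hτ fun t ht x => ?_)
    have e := hgen t ht x
    simp only [zero_smul, add_zero, mul_zero, zero_mul, zero_add] at e
    exact e
  -- `σ ≠ 0 ≠ τ`: the vertex `θ = -τ/(2σ)` is interior or future
  obtain ⟨θ, rfl⟩ : ∃ θ : ℝ, τ = -2 * σ * θ := ⟨-τ / (2 * σ), by field_simp⟩
  have hθ0 : θ ≠ 0 := by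
    rintro rfl
    exact hτ (by ring)
  have hgen' : ∀ t < 0, ∀ x, fderiv ℝ (u t) x (a + σ • x + A x) + σ • u t x +
      (2 * σ * (t - θ)) • timeDeriv u t x - A (u t x) = 0 := by
    intro t ht x
    have e := hgen t ht x
    have : 2 * σ * t + -2 * σ * θ = 2 * σ * (t - θ) := by ring
    rwa [this] at e
  rcases lt_or_gt_of_ne hθ0 with hθ | hθ
  · exact residual_simSymmetry_of_vanishes fun t ht x =>
      stub_interiorVertexVanishing C u hu' a σ A θ 0 hA hσ hθ hθ.le le_rfl hgen' t ht x
  · by_cases hA0 : A = 0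
    · subst hA0
      refine residual_simSymmetry_of_vanishes
        (stub_futureVertexLiouvilleIrrotational C u hu' a σ θ hσ hθ fun t ht x => ?_)
      have e := hgen' t ht x
      simp only [zero_apply, add_zero, sub_zero] at e
      exact e
    · exact residual_simSymmetry_of_vanishes (hRot C u hu' a σ A θ hA hA0 hσ hθ hgen')

/-- **The line's composition, modulo the sibling crux** `SymmetricLiouville` (stmt-4053), which supplies
the rotated leaf (`rss_futureVertexLiouvilleRotated_of_symmetricLiouville`, p88100). CONDITIONAL on
`SymmetricLiouville`. [folklore] -/
theorem forcedSymmetry_of_extended_of_symmetricLiouville (hS : SymmetricLiouville)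
    (hE : ∀ (C : ℝ) (u : ℝ → EuclideanSpace ℝ (Fin 3) → EuclideanSpace ℝ (Fin 3)),
      Literature.Analysis.FluidPDE.IsTypeIAncientMild C u →
      ∃ (a : EuclideanSpace ℝ (Fin 3)) (σ : ℝ) (A : EuclideanSpace ℝ (Fin 3) →L[ℝ] EuclideanSpace ℝ (Fin 3)) (τ : ℝ),
        (∀ x, inner ℝ (A x) x = 0) ∧ ¬ (a = 0 ∧ σ = 0 ∧ A = 0 ∧ τ = 0) ∧
        ∀ t < 0, ∀ x, fderiv ℝ (u t) x (a + σ • x + A x) + σ • u t x +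
          (2 * σ * t + τ) • Literature.Analysis.FluidPDE.timeDeriv u t x - A (u t x) = 0) :
    ForcedSymmetry :=
  forcedSymmetry_of_extended_of_rotatedLeaf (rss_futureVertexLiouvilleRotated_of_symmetricLiouville hS) hE

/-- **The target is the residual too.** Given `SymmetricLiouville`, the route target
`X = TypeIAncientLiouville` (no nonzero Type-I KNSS-mild ancient field) is EQUIVALENT to extended forced
symmetry: `⇒` because the zero field has every symmetry; `⇐` by the previous theorem and the route's
dichotomy `ForcedSymmetry ∧ SymmetricLiouville ⇒ X`. So the residual stub of line time-anchor-bootstrap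
is exactly the Type-I Liouville problem modulo its symmetric cases (crux-sized). CONDITIONAL on
`SymmetricLiouville`. [folklore] -/
theorem typeIAncientLiouville_iff_extended_of_symmetricLiouville (hS : SymmetricLiouville) :
    TypeIAncientLiouville ↔
      ∀ (C : ℝ) (u : ℝ → EuclideanSpace ℝ (Fin 3) → EuclideanSpace ℝ (Fin 3)),
        Literature.Analysis.FluidPDE.IsTypeIAncientMild C u →
        ∃ (a : EuclideanSpace ℝ (Fin 3)) (σ : ℝ) (A : EuclideanSpace ℝ (Fin 3) →L[ℝ] EuclideanSpace ℝ (Fin 3)) (τ : ℝ),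
          (∀ x, inner ℝ (A x) x = 0) ∧ ¬ (a = 0 ∧ σ = 0 ∧ A = 0 ∧ τ = 0) ∧
          ∀ t < 0, ∀ x, fderiv ℝ (u t) x (a + σ • x + A x) + σ • u t x +
            (2 * σ * t + τ) • Literature.Analysis.FluidPDE.timeDeriv u t x - A (u t x) = 0 := by
  constructor
  · intro hX C u hu
    have h0 : ∀ t < 0, ∀ x, u t x = 0 := hX C u (isTypeIAncientMild_iff.1 hu)
    obtain ⟨a, σ, A, hA, hne, h⟩ := residual_simSymmetry_of_vanishes h0
    refine ⟨a, σ, A, 0, hA, fun hh => hne ⟨hh.1, hh.2.1, hh.2.2.1⟩, fun t ht x => ?_⟩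
    rw [add_zero]
    exact h t ht x
  · intro hE C u hu
    obtain ⟨a, σ, A, hA, hne, hL⟩ := forcedSymmetry_of_extended_of_symmetricLiouville hS hE C u hu
    exact hS C u hu a σ A hA hne hL

end Summit.NavierStokesRegularity.NavierStokesRegularity.Theorems

end
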